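import Summits.Parity.GeneralizedHardyLittlewood.Theorems.LeeYangFibresCellParityLawKernelDefs
import Summits.Parity.GeneralizedHardyLittlewood.Theorems.LeeYangFibresCellParityLawPrLawTwoAssembly
import Summits.Parity.GeneralizedHardyLittlewood.Theorems.LeeYangFibresCellParityLawWalshStep
import Summits.Parity.GeneralizedHardyLittlewood.Theorems.LeeYangFibresCellParityLawSingularRatio
import Summits.Parity.GeneralizedHardyLittlewood.Theorems.LeeYangFibresCellParityLawEulerRatio
import Summits.Parity.GeneralizedHardyLittlewood.Theorems.LeeYangFibresCellParityLawModelDensityBounds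
import Literature.NumberTheory.Sieve.LinearFormsRoughTupleBound
import Literature.NumberTheory.Sieve.LinearEquationsInPrimesSubsystems
import Literature.NumberTheory.Sieve.LinearEquationsInPrimesCountSandwich
import HarnessLib

/-!
# Route `LeeYangFibres`, crux `CellParityLaw` (stmt-Parity-14109), line `section-annihilator`:
# the registered stub `stub_geThreeAssembly` — the `u ≥ 3` rung assembled

Skeleton v13 (lead c2). This file proves the glue statement `GeThreeAssembly`: the raw section law
(`RawSectionLawAt t`, the kernel's output on a LOCALISED body of LARGE fibre mass, in kernel currency), the
main-term conversion (`MainTermConversion`), the `secSeqB` localisation costs (`SectionSeqBCells`), the convexity of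
the localised body (`SectionSeqBFacts`) and the landed preparations (`PrLawTwoPrep`: degenerate cases and cells `≤`
fibre mass; `EulerRatioIdentity`; `stub_singularRatio` for `H ≤ C (log log N)^D`; `uniformRoughTupleBound` for
`F ≤ C (log log N)^t N/log^t N`; `stub_modelDensityBounds` for `a_m ≤ C/log N`) give Bombieri's `P_r` law for the
sections at every roughness `u ≥ 3`, `SectionPrLawAtU u t`.

Proof. Degenerate coordinate: every cell and `H·F` vanish (`PrLawTwoPrep` (a)). Otherwise localise the body to
`K' = K ∩ {ψ_i > x/Λ}` (`x = 2LN`, `Λ = (log N)^{t+2}`): cells and fibre mass change by `≤ x/Λ + 1`. If the localised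
mass is `< N/log^{t+2} N`, every cell and the model are below the budget. Otherwise the raw law at
`Bκ = B + t + D + 1` gives ONE `δ`; its error `V F'/(log log N)^{Bκ} + N/log^{t+2} N`, the conversion error
`C H F'/log² N` and the two localisation errors are each `≤ N/(8 log^{t+1} N (log log N)^B)`.

References: E. Bombieri, RIMS Kôkyûroku 294 (1977) p. 5 [BombieriRIMS1977]; J. Friedlander, H. Iwaniec,
Ann. Sc. Norm. Sup. Pisa (4) 5 (1978) §4 [FriedlanderIwaniecPisa1978].
-/

noncomputable section

open scoped BigOperators Topology Classical
open Finset Filter Literature.NumberTheory.Sieve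

namespace Summit.Parity.GeneralizedHardyLittlewood.Cruxes.CellParityLaw.SectionAnnihilator

namespace GeThreeAssemblyAux

/-- Eventually `c (log log N)^k ≤ log N` and friends are `PrLawTwoAssemblyAux`; here: eventually
`8 (log N)^{k} ≤ N`. -/
theorem eventually_logpow_le_self (k : ℕ) : ∀ᶠ N : ℕ in atTop, 8 * Real.log (N : ℝ) ^ k ≤ N := by
  have h := (Real.isLittleO_pow_log_id_atTop (n := k)).def (show (0 : ℝ) < 1 / 8 by norm_num)
  filter_upwards [tendsto_natCast_atTop_atTop.eventually h, eventually_ge_atTop 1] with N hN hN1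
  have hN0 : (0 : ℝ) ≤ N := Nat.cast_nonneg N
  have hlog0 : 0 ≤ Real.log (N : ℝ) := Real.log_nonneg (by exact_mod_cast hN1)
  rw [Real.norm_of_nonneg (pow_nonneg hlog0 _), id, Real.norm_of_nonneg hN0] at hN
  linarith

/-- `|a - d| ≤ |a - b| + |b - c| + |c - d|` with one more point: four-step triangle inequality. -/
theorem abs_sub_le_four (a b c d e : ℝ) : |a - e| ≤ |a - b| + |b - c| + |c - d| + |d - e| := by
  linarith [abs_sub_le a b e, abs_sub_le b c e, abs_sub_le c d e]

end GeThreeAssemblyAux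

set_option maxHeartbeats 400000 in
open GeThreeAssemblyAux PrLawTwoAssemblyAux in
/-- **`stub_geThreeAssembly`** (registered stub of skeleton v13, line `section-annihilator`): the `u ≥ 3` rung
of Bombieri's `P_r` law for the sections, assembled — `GeThreeAssembly`. -/
theorem stub_geThreeAssembly : GeThreeAssembly := by
  intro hF hC hMT hP hE hRawAll t ht hA u hu3 L B
  have hu : 2 ≤ u := by omega
  -- the vacuous case `L = 0`
  rcases Nat.eq_zero_or_pos L with hL0 | hLpos
  · refine ⟨0, fun N _ Ψ hΨ hL K _ _ i => ?_⟩
    have h1 : (1 : ℝ) ≤ (L : ℝ) := one_le_of_affLinSize_le Ψ hΨ hL i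
    rw [hL0, Nat.cast_zero] at h1
    exact absurd h1 (by norm_num)
  have hL1 : 1 ≤ L := hLpos
  have hL1r : (1 : ℝ) ≤ L := by exact_mod_cast hL1
  -- constants
  obtain ⟨hDeg, -, hIncl, -, -⟩ := hP
  obtain ⟨Ndeg, hdeg⟩ := hDeg t L u hu
  obtain ⟨Cs, hCs0, D, Ns, hSR⟩ := stub_singularRatio t L
  obtain ⟨CR, NR, hRT⟩ := uniformRoughTupleBound t L u (by omega)
  obtain ⟨Cm, hCm0, Nm, hMTN⟩ := hMT t L u hu
  obtain ⟨_, Ca, _, hCa0, Na, hMDB⟩ := stub_modelDensityBounds u hu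
  set cR : ℝ := |CR| with hcR
  set K₃ : ℝ := Cm * Cs * cR with hK₃
  have hK₃0 : 0 ≤ K₃ := by positivity
  set Bκ : ℕ := B + t + D + 1 with hBκ
  obtain ⟨NW, hRawN⟩ := hRawAll t ht hA L u Bκ hu
  -- thresholds
  have hz2 : ∀ᶠ N : ℕ in atTop, (2 : ℝ) ≤ (N : ℝ) ^ ((1 : ℝ) / u) :=
    ((tendsto_rpow_atTop (by positivity)).comp tendsto_natCast_atTop_atTop).eventually_ge_atTop 2
  obtain ⟨N₀, hN₀⟩ := Filter.eventually_atTop.1 (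
    (eventually_const_mul_loglog_pow_le B (16 * L) (by positivity)).and
    ((eventually_const_mul_loglog_pow_le (D + t + B) (8 * K₃) (by positivity)).and
    ((eventually_const_mul_loglog_pow_le D (2 * Ca * Cs) (by positivity)).and
    ((eventually_le_loglog (max 1 (8 * K₃))).and
    ((eventually_logpow_le_self (t + 1 + B)).and
    ((((Real.tendsto_log_atTop.comp tendsto_natCast_atTop_atTop).eventually_ge_atTop (1 : ℝ))).and
    (hz2.and ((eventually_ge_atTop Ndeg).and ((eventually_ge_atTop Ns).and ((eventually_ge_atTop NR).and
    ((eventually_ge_atTop Nm).and ((eventually_ge_atTop Na).and ((eventually_ge_atTop NW).and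
    (eventually_ge_atTop 3))))))))))))))
  refine ⟨N₀, fun N hN Ψ hΨ hL K hK hKN i j' hj' => ?_⟩
  obtain ⟨he1, he5, he6, hll, heN, hl1, hz2N, hNdeg, hNs, hNR, hNm, hNa, hNW, hN3⟩ := hN₀ N hN
  have hN0 : (0 : ℝ) < N := by exact_mod_cast (by omega : 0 < N)
  set ℓ : ℝ := Real.log (N : ℝ) with hℓ
  set ℓℓ : ℝ := Real.log ℓ with hℓℓ
  have hℓ1 : 1 ≤ ℓ := hl1
  have hℓ0 : 0 < ℓ := by linarith
  have hℓℓ1 : 1 ≤ ℓℓ := le_trans (le_max_left _ _) hll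
  have hℓℓ0 : 0 < ℓℓ := by linarith
  have hℓℓK : 8 * K₃ ≤ ℓℓ := le_trans (le_max_right _ _) hll
  have hℓℓℓ : ℓℓ ≤ ℓ := by
    have := Real.log_le_sub_one_of_pos hℓ0; rw [← hℓℓ] at this; linarith
  -- the budget `E = 8Q`
  set E : ℝ := (N : ℝ) / (ℓ ^ (t + 1) * ℓℓ ^ B) with hEdef
  set Q : ℝ := (N : ℝ) / (8 * (ℓ ^ (t + 1) * ℓℓ ^ B)) with hQdef
  have hE0 : 0 ≤ E := budget_nonneg hN3 t B
  have hEQ : E = 8 * Q := by rw [hEdef, hQdef]; field_simp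
  -- quarter-budget bookkeeping
  set T : ℝ := xOf L N / lamOf N t with hTdef
  have hT : T = 2 * (L : ℝ) * N / ℓ ^ (t + 2) := rfl
  have hT0 : 0 ≤ T := by rw [hT]; positivity
  have hTQ : T + 1 ≤ 2 * Q := by
    have h1 : T ≤ Q := by
      rw [hT, hQdef, div_le_div_iff₀ (by positivity) (by positivity)]
      -- `2LN · 8 ℓ^{t+1} ℓℓ^B ≤ N ℓ^{t+2}` from `16 L ℓℓ^B ≤ ℓ`
      have hNl : 0 ≤ (N : ℝ) * ℓ ^ (t + 1) := by positivity
      calc 2 * (L : ℝ) * N * (8 * (ℓ ^ (t + 1) * ℓℓ ^ B)) = N * ℓ ^ (t + 1) * (16 * L * ℓℓ ^ B) := by ring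
        _ ≤ N * ℓ ^ (t + 1) * ℓ := mul_le_mul_of_nonneg_left he1 hNl
        _ = N * ℓ ^ (t + 2) := by ring
    have h2 : 1 ≤ Q := by
      rw [hQdef, le_div_iff₀ (by positivity), one_mul]
      calc 8 * (ℓ ^ (t + 1) * ℓℓ ^ B) ≤ 8 * (ℓ ^ (t + 1) * ℓ ^ B) := by gcongr
        _ = 8 * ℓ ^ (t + 1 + B) := by ring
        _ ≤ N := heN
    linarith
  have hNQ : (N : ℝ) / ℓ ^ (t + 2) ≤ Q := by
    rw [hQdef, div_le_div_iff₀ (by positivity) (by positivity)]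
    have h8 : 8 * ℓℓ ^ B ≤ ℓ := by
      have : 8 * ℓℓ ^ B ≤ 16 * (L : ℝ) * ℓℓ ^ B := by nlinarith [pow_nonneg hℓℓ0.le B]
      linarith
    have hNl : 0 ≤ (N : ℝ) * ℓ ^ (t + 1) := by positivity
    calc (N : ℝ) * (8 * (ℓ ^ (t + 1) * ℓℓ ^ B)) = (N : ℝ) * ℓ ^ (t + 1) * (8 * ℓℓ ^ B) := by ring
      _ ≤ (N : ℝ) * ℓ ^ (t + 1) * ℓ := mul_le_mul_of_nonneg_left h8 hNl
      _ = (N : ℝ) * ℓ ^ (t + 2) := by ring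
  -- degenerate / non-degenerate
  by_cases hdg : (∃ p : ℕ, p.Prime ∧ sectionDensity Ψ i p = 1) ∨ singularProduct (Fin.removeNth i Ψ) = 0
  · obtain ⟨hcells, hHB⟩ := hdeg N hNdeg Ψ hΨ hL K i j' hdg
    refine ⟨1, zero_le_one, one_le_two, fun m _ _ => ?_⟩
    have hmodel : (1 + ((1 : ℝ) - 1) * (-1 : ℝ) ^ m) * modelDensity N u m * sectionH Ψ i *
        (sectionMass Ψ K N u i j' 1 : ℝ) = 0 := by
      rw [mul_assoc, hHB, mul_zero]
    rw [hcells m, hmodel, Nat.cast_zero, sub_zero, abs_zero]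
    exact hE0
  push Not at hdg
  obtain ⟨hne1, hS⟩ := hdg
  have hlt1 : ∀ p : ℕ, p.Prime → sectionDensity Ψ i p < 1 := fun p hp =>
    lt_of_le_of_ne (sectionDensity_prime_le_one Ψ i hp) (hne1 p hp)
  -- `H`, `0 ≤ H ≤ Cs ℓℓ^D`
  set Hh : ℝ := sectionH Ψ i with hHh
  obtain ⟨hS'0, hS0, hSle⟩ := hSR N hNs Ψ hΨ hL i
  have hS'pos : 0 < singularProduct (Fin.removeNth i Ψ) := lt_of_le_of_ne hS'0 (Ne.symm hS)
  have hHeq : Hh = singularProduct Ψ / singularProduct (Fin.removeNth i Ψ) :=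
    EulerRatioAux.sectionH_eq Ψ hΨ i hS
  have hH0 : 0 ≤ Hh := by rw [hHeq]; exact div_nonneg hS0 hS'0
  have hHle : Hh ≤ Cs * ℓℓ ^ D := by rw [hHeq, div_le_iff₀ hS'pos]; exact hSle
  -- the localised body
  set K' : Set (Fin 1 → ℝ) := K ∩ {v | T < (Ψ i).realEval v} with hK'
  have hK'conv : Convex ℝ K' := (hF t Ψ K N u i j').2.2.2.2.2.2 T hK
  have hK'sub : K' ⊆ realBox 1 N := Set.inter_subset_left.trans hKN
  have hK'T : K' ⊆ {v | xOf L N / lamOf N t < (Ψ i).realEval v} := Set.inter_subset_right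
  set F : ℝ := (sectionMass Ψ K N u i j' 1 : ℝ) with hFdef
  set F' : ℝ := (sectionMass Ψ K' N u i j' 1 : ℝ) with hF'def
  have hF0 : 0 ≤ F := Nat.cast_nonneg _
  have hF'0 : 0 ≤ F' := Nat.cast_nonneg _
  obtain ⟨-, -, -, -, hloc, hmono⟩ := hC t Ψ K N u i j'
  have hcoeff : (Ψ i).coeff ≠ 0 := hΨ.1 i
  obtain ⟨hmonoCell, hmonoMass⟩ := hmono K' Set.inter_subset_left
  have hF'F : F' ≤ F := by rw [hF'def, hFdef]; exact_mod_cast hmonoMass 1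
  have hFF' : F ≤ F' + (T + 1) := (hloc T hT0 hcoeff 1 le_rfl).2
  -- `F ≤ CR ℓℓ^t N/ℓ^t ≤ cR ℓℓ^t N/ℓ^t`
  have hFle : F ≤ cR * ℓℓ ^ t * N / ℓ ^ t := by
    have h1 := (hIncl t Ψ K N u i j' hz2N).2
    have h2 := hRT N hNR (Fin.removeNth i Ψ) (SingularRatio.isNondegenerateSystem_removeNth hΨ i)
      ((affLinSize_removeNth_le Ψ i (N : ℝ)).trans hL)
    have h3 : F ≤ CR * Real.log (Real.log N) ^ t * N / Real.log N ^ t := by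
      rw [hFdef]; exact le_trans (Nat.cast_le.mpr h1) h2
    refine h3.trans ?_
    have hX : 0 ≤ ℓℓ ^ t * N / ℓ ^ t := by positivity
    calc CR * Real.log (Real.log N) ^ t * N / Real.log N ^ t = CR * (ℓℓ ^ t * N / ℓ ^ t) := by
          rw [hℓℓ, hℓ]; ring
      _ ≤ cR * (ℓℓ ^ t * N / ℓ ^ t) := mul_le_mul_of_nonneg_right (le_abs_self CR) hX
      _ = cR * ℓℓ ^ t * N / ℓ ^ t := by ring
  -- model densities
  have ha0 : ∀ m, 0 ≤ modelDensity N u m := fun m => WalshStepAux.modelDensity_nonneg N u m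
  have hale : ∀ m, modelDensity N u m ≤ Ca / ℓ := fun m => (hMDB N hNa).1 m
  -- cells of the localised body are below its fibre mass
  have hcellF' : ∀ m, (cell Ψ K' N u (i.insertNth m j') : ℝ) ≤ F' := fun m => by
    rw [hF'def]; exact_mod_cast (hIncl t Ψ K' N u i j' hz2N).1 m
  -- the model-side constant `2 Ca Cs ℓℓ^D/ℓ ≤ 1`
  have hmc : 2 * (Ca / ℓ) * (Cs * ℓℓ ^ D) ≤ 1 := by
    rw [show 2 * (Ca / ℓ) * (Cs * ℓℓ ^ D) = (2 * Ca * Cs * ℓℓ ^ D) / ℓ by ring, div_le_one hℓ0]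
    exact he6
  -- the generic model bound `|w a_m H X| ≤ (2 Ca Cs ℓℓ^D/ℓ) X` for `X ≥ 0`, `|w| ≤ 2`
  have hmodel_le : ∀ (δ : ℝ), 0 ≤ δ → δ ≤ 2 → ∀ m (X : ℝ), 0 ≤ X →
      |(1 + (δ - 1) * (-1 : ℝ) ^ m) * modelDensity N u m * Hh * X| ≤ 2 * (Ca / ℓ) * (Cs * ℓℓ ^ D) * X := by
    intro δ hδ0 hδ2 m X hX
    rw [abs_mul, abs_mul, abs_mul, abs_of_nonneg (ha0 m), abs_of_nonneg hH0, abs_of_nonneg hX]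
    have hw := WalshStepAux.abs_parityWeight_le hδ0 hδ2 m
    have h1 : |1 + (δ - 1) * (-1 : ℝ) ^ m| * modelDensity N u m ≤ 2 * (Ca / ℓ) :=
      mul_le_mul hw (hale m) (ha0 m) (by norm_num)
    have h2 : |1 + (δ - 1) * (-1 : ℝ) ^ m| * modelDensity N u m * Hh ≤ 2 * (Ca / ℓ) * (Cs * ℓℓ ^ D) :=
      mul_le_mul h1 hHle hH0 (mul_nonneg (by norm_num) (div_nonneg hCa0.le hℓ0.le))
    exact mul_le_mul_of_nonneg_right h2 hX
  by_cases hsmall : F' < (N : ℝ) / ℓ ^ (t + 2)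
  · -- small localised mass: every cell and the model are below the budget
    refine ⟨1, zero_le_one, one_le_two, fun m hm _ => ?_⟩
    have hcellK : (cell Ψ K N u (i.insertNth m j') : ℝ) ≤ F' + (T + 1) :=
      (hloc T hT0 hcoeff m hm).1.trans (by linarith [hcellF' m])
    have hcell3Q : (cell Ψ K N u (i.insertNth m j') : ℝ) ≤ 3 * Q := by linarith
    have hF3Q : F ≤ 3 * Q := by linarith
    have hmod : |(1 + ((1 : ℝ) - 1) * (-1 : ℝ) ^ m) * modelDensity N u m * Hh * F| ≤ 3 * Q := by
      refine (hmodel_le 1 zero_le_one one_le_two m F hF0).trans ?_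
      calc 2 * (Ca / ℓ) * (Cs * ℓℓ ^ D) * F ≤ 2 * (Ca / ℓ) * (Cs * ℓℓ ^ D) * (3 * Q) := by gcongr
        _ ≤ 1 * (3 * Q) := by gcongr
        _ = 3 * Q := one_mul _
    calc |(cell Ψ K N u (i.insertNth m j') : ℝ) -
          (1 + ((1 : ℝ) - 1) * (-1 : ℝ) ^ m) * modelDensity N u m * sectionH Ψ i * F|
        ≤ |(cell Ψ K N u (i.insertNth m j') : ℝ)| +
          |(1 + ((1 : ℝ) - 1) * (-1 : ℝ) ^ m) * modelDensity N u m * Hh * F| := abs_sub _ _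
      _ ≤ 3 * Q + 3 * Q := add_le_add (by rw [abs_of_nonneg (Nat.cast_nonneg _)]; exact hcell3Q) hmod
      _ ≤ E := by rw [hEQ]; linarith [show 0 ≤ Q from by linarith]
  · -- large localised mass: the raw law on `K'`
    push Not at hsmall
    have hlarge : (N : ℝ) / Real.log N ^ (t + 2) ≤ sectionMass Ψ K' N u i j' 1 := hsmall
    obtain ⟨δ, hδ0, hδ2, hraw⟩ := hRawN N hNW Ψ hΨ hL K' hK'conv hK'sub i j' hj' hlt1 hK'T hlarge
    obtain ⟨hVle, hconv⟩ := hMTN N hNm Ψ hΨ hL i hlt1 hS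
    refine ⟨δ, hδ0, hδ2, fun m hm _ => ?_⟩
    -- notation for the pieces
    set V : ℝ := ∏ p ∈ Nat.primesBelow ⌈zOf N u⌉₊, (1 - sectionDensity Ψ i p) with hV
    set w : ℝ := 1 + (δ - 1) * (-1 : ℝ) ^ m with hw
    set G : ℝ := Real.exp Real.eulerMascheroniConstant * V with hG
    set rat : ℝ := roughCellDensity m (Real.log (xOf L N) / Real.log (zOf N u)) /
      (Real.log (xOf L N) / Real.log (zOf N u)) with hrat
    set c₀ : ℝ := (cell Ψ K N u (i.insertNth m j') : ℝ) with hc₀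
    set c₁ : ℝ := (cell Ψ K' N u (i.insertNth m j') : ℝ) with hc₁
    have hrawm : |c₁ - w * rat * G * F'| ≤ V * F' / Real.log (Real.log N) ^ Bκ + (N : ℝ) / Real.log N ^ (t + 2) :=
      hraw m hm
    have hconvm : |w * rat * G * F' - w * modelDensity N u m * Hh * F'| ≤ Cm * Hh * F' / Real.log N ^ 2 :=
      hconv δ hδ0 hδ2 m hm F' hF'0
    -- `V ≤ Cm H/ℓ`
    have hV0 : 0 ≤ V := Finset.prod_nonneg fun p hp =>
      sub_nonneg.mpr (sectionDensity_prime_le_one Ψ i (Nat.prime_of_mem_primesBelow hp))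
    have hVle' : V ≤ Cm * Hh / ℓ := by
      have hG1 : 1 ≤ Real.exp Real.eulerMascheroniConstant :=
        Real.one_le_exp (by linarith [Real.one_half_lt_eulerMascheroniConstant])
      calc V = 1 * V := (one_mul _).symm
        _ ≤ Real.exp Real.eulerMascheroniConstant * V := mul_le_mul_of_nonneg_right hG1 hV0
        _ ≤ Cm * Hh / ℓ := hVle
    -- E1: localisation of the cell
    have hE1 : |c₀ - c₁| ≤ 2 * Q := by
      have h1 : c₁ ≤ c₀ := by rw [hc₀, hc₁]; exact_mod_cast hmonoCell (i.insertNth m j')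
      have h2 : c₀ ≤ c₁ + (T + 1) := (hloc T hT0 hcoeff m hm).1
      rw [abs_of_nonneg (by linarith)]; linarith
    -- E2: the raw error
    have hE2 : V * F' / Real.log (Real.log N) ^ Bκ + (N : ℝ) / Real.log N ^ (t + 2) ≤ Q + Q := by
      refine add_le_add ?_ hNQ
      change V * F' / ℓℓ ^ Bκ ≤ Q
      have hVF : V * F' ≤ (Cm * Hh / ℓ) * (cR * ℓℓ ^ t * N / ℓ ^ t) :=
        mul_le_mul hVle' (hF'F.trans hFle) hF'0 (div_nonneg (mul_nonneg hCm0 hH0) hℓ0.le)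
      have hstep : V * F' ≤ K₃ * ℓℓ ^ (D + t) * N / ℓ ^ (t + 1) := by
        refine hVF.trans ?_
        calc Cm * Hh / ℓ * (cR * ℓℓ ^ t * N / ℓ ^ t) ≤ Cm * (Cs * ℓℓ ^ D) / ℓ * (cR * ℓℓ ^ t * N / ℓ ^ t) := by
              gcongr
          _ = K₃ * ℓℓ ^ (D + t) * N / ℓ ^ (t + 1) := by rw [hK₃, div_mul_div_comm]; ring
      rw [div_le_iff₀ (pow_pos hℓℓ0 _)]
      refine hstep.trans ?_
      -- `Q ℓℓ^{Bκ} = N ℓℓ^{D+t} ℓℓ/(8 ℓ^{t+1})`, and `8 K₃ ≤ ℓℓ`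
      have e1 : Q * ℓℓ ^ Bκ = (N : ℝ) * ℓℓ ^ (D + t) * ℓℓ / (8 * ℓ ^ (t + 1)) := by
        rw [hQdef, hBκ, div_mul_eq_mul_div, div_eq_div_iff (by positivity) (by positivity)]
        ring
      rw [e1, div_le_div_iff₀ (by positivity) (by positivity)]
      have hX : 0 ≤ (N : ℝ) * ℓℓ ^ (D + t) * ℓ ^ (t + 1) := by positivity
      calc K₃ * ℓℓ ^ (D + t) * N * (8 * ℓ ^ (t + 1)) = (8 * K₃) * ((N : ℝ) * ℓℓ ^ (D + t) * ℓ ^ (t + 1)) := by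
            ring
        _ ≤ ℓℓ * ((N : ℝ) * ℓℓ ^ (D + t) * ℓ ^ (t + 1)) := mul_le_mul_of_nonneg_right hℓℓK hX
        _ = (N : ℝ) * ℓℓ ^ (D + t) * ℓℓ * ℓ ^ (t + 1) := by ring
    -- E3: the conversion error
    have hE3 : Cm * Hh * F' / Real.log N ^ 2 ≤ Q := by
      change Cm * Hh * F' / ℓ ^ 2 ≤ Q
      have hstep : Cm * Hh * F' ≤ K₃ * ℓℓ ^ (D + t) * N / ℓ ^ t := by
        calc Cm * Hh * F' ≤ Cm * (Cs * ℓℓ ^ D) * (cR * ℓℓ ^ t * N / ℓ ^ t) :=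
              mul_le_mul (mul_le_mul_of_nonneg_left hHle hCm0) (hF'F.trans hFle) hF'0
                (mul_nonneg hCm0 (by positivity))
          _ = K₃ * ℓℓ ^ (D + t) * N / ℓ ^ t := by rw [hK₃]; ring
      rw [div_le_iff₀ (pow_pos hℓ0 2)]
      refine hstep.trans ?_
      -- `Q ℓ² = N ℓ/(8 ℓ^t ℓℓ^B)`, and `8 K₃ ℓℓ^{D+t+B} ≤ ℓ`
      have e2 : Q * ℓ ^ 2 = (N : ℝ) * ℓ / (8 * ℓ ^ t * ℓℓ ^ B) := by
        rw [hQdef, div_mul_eq_mul_div, div_eq_div_iff (by positivity) (by positivity)]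
        ring
      rw [e2, div_le_div_iff₀ (by positivity) (by positivity)]
      have hX : 0 ≤ (N : ℝ) * ℓ ^ t := by positivity
      calc K₃ * ℓℓ ^ (D + t) * N * (8 * ℓ ^ t * ℓℓ ^ B) = (8 * K₃ * ℓℓ ^ (D + t + B)) * ((N : ℝ) * ℓ ^ t) := by
            ring
        _ ≤ ℓ * ((N : ℝ) * ℓ ^ t) := mul_le_mul_of_nonneg_right he5 hX
        _ = (N : ℝ) * ℓ * ℓ ^ t := by ring
    -- E4: localisation of the fibre mass inside the model
    have hE4 : |w * modelDensity N u m * Hh * F' - w * modelDensity N u m * Hh * F| ≤ 2 * Q := by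
      rw [show w * modelDensity N u m * Hh * F' - w * modelDensity N u m * Hh * F =
        -(w * modelDensity N u m * Hh * (F - F')) by ring, abs_neg]
      refine (hmodel_le δ hδ0 hδ2 m (F - F') (by linarith)).trans ?_
      calc 2 * (Ca / ℓ) * (Cs * ℓℓ ^ D) * (F - F') ≤ 1 * (F - F') := by gcongr
        _ ≤ 2 * Q := by linarith
    -- assemble
    calc |c₀ - w * modelDensity N u m * sectionH Ψ i * F|
        ≤ |c₀ - c₁| + |c₁ - w * rat * G * F'| + |w * rat * G * F' - w * modelDensity N u m * Hh * F'| +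
            |w * modelDensity N u m * Hh * F' - w * modelDensity N u m * Hh * F| := abs_sub_le_four _ _ _ _ _
      _ ≤ 2 * Q + (Q + Q) + Q + 2 * Q := by
          gcongr
          · exact hrawm.trans hE2
          · exact hconvm.trans hE3
      _ ≤ E := by rw [hEQ]; linarith [show 0 ≤ Q from by linarith]

end Summit.Parity.GeneralizedHardyLittlewood.Cruxes.CellParityLaw.SectionAnnihilator

end
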